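/-
Origin: expansion seat `planner-pub-hodgecm-mc-theta-3-g14-0`, handover (K13) 2026-08-20T11:50:37Z md5 fdc3eb21206907f5f892f2df6195eea3 (138 l., 3 theorems; NEW additive leaf over (K12) only; (J-μ) hμ at the OG pin DISCHARGED: η·χ_T·dIotaAt (archOf t) = (printPlacesW … (pinnedVacs … (−μ♯♯ c 0) (−μ♯♯ c 1)) t)⁻¹, any datum, any hW; sha256 7e0707c2e600) (`HOME/mc/pub-hodgecm-mc-theta-3-g14/lean/stage50/HodgeCM/Model/ArchPinWeightDischarge.lean`, md5 fdc3eb212069, 138 lines);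
landed by the second packager p2 gen 7 (p2-g7) in gate run 50 as `HodgeCM/Model/ArchPinWeightDischarge.lean` (verbatim).
-/
/-
Origin: speedrun cell pub-hodgecm, MODEL-CONSTRUCTION sub-cell, lineage mc-theta-3 (theta supply / second-lift lane, BINDER-OWNERS row 5 `S` slot;
(J-μ) theta share), seat planner-pub-hodgecm-mc-theta-3-g14-0 (gen 14), 2026-08-20.  Target in PKG: `HodgeCM/Model/ArchPinWeightDischarge.lean`
(NEW additive leaf; imports ONLY this lineage's RUN-50 (K12) `Model/ArchPinTorusIdentity`).
KERNEL only: 0 records / Prop-valued definitions / cites, 0 proof holes; intended closure {propext, Classical.choice, Quot.sound}.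
-/
import Summits.HodgeConjecture.HodgeCM.Model.ArchPinTorusIdentity

/-!
# (J-μ) DISCHARGED AT THE W PIN: binder-2's scalar identity `hμ`, both sides, under the OG guard

Binder-2's census junction (PKG #39 `HypCensus.omgW_ins_vacuum_eq_of_weight`, (T12) `HypCensus.omgW_ins_eq_of_weight`) turns rows 17/18/19
of E into ONE scalar identity on the archimedean see-saw torus `T(L⁺ ⊗ ℝ)`, read at the torus point `u_t := archOf … t` behind a printed
torus point `t`:

  `hμ : ∀ t, η(1, (diag u_t)_𝔸) · χ_T(u_t) · dIotaAt(u_t) = (printPlacesW … t)⁻¹`.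

(K12) `eta_pinTorusChar_dIotaAt_GOG` computed the THETA side at E's pin of record (OG guard `SInstance.GOG`, Stage-B `η` with
`χW := SInstance.χWR … (μ♯♯)`, `μ♯♯ := muSharp₂₃ μ`): `= archWeight (μ♯♯ c 0) (fst u) · archWeight (μ♯♯ c 1) (snd u)` for EVERY `u`.
This leaf closes the identity: with the pinned vacuum characters of exponents `m₁ := −μ♯♯ c 0`, `m₂ := −μ♯♯ c 1` (glue-1's #398SW
`homg` text) the PRINTED side is `(weight m₁ m₂ u_t)⁻¹ = archWeight (μ♯♯ c 0) (fst u_t) · archWeight (μ♯♯ c 1) (snd u_t)` (pv11's KERNEL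
dictionary `printPlacesW_pinned_eq_weight` + `archWeight_neg`), for ANY place-datum family `datum` (so the statement survives every re-typing
of binder-2's `datumAt`).

## Main statements (namespace `HodgeCM.Model.ArchSideTerm`)

* `inv_printPlacesW_pinned_neg` (§1, pure torus bookkeeping): `(printPlacesW … (pinnedVacs kind (−n₁) (−n₂)) t)⁻¹ = archWeight n₁ (fst u_t) ·
  archWeight n₂ (snd u_t)`.
* **`hμ_GOG`** (§2): binder-2's `hμ` AT E's PIN OF RECORD, for every guarded `(V, c)`, every sign fact `hW`, every `datum`, every `t` —
  hypothesis-free.  Consumer recipe (binder-2 / glue-1): `homg V c := fun hW f t φ => HypCensus.omgW_ins_eq_of_weight … (hμ_GOG … V c hc hW _ ) f t φ`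
  inside the `fun V c hc h6 hcan => …` of #398SW.
-/

set_option autoImplicit false

noncomputable section

open scoped Matrix Classical
open NumberField (InfinitePlace maximalRealSubfield IsCMField)
open NumberField.mixedEmbedding (mixedSpace)
open Literature.NumberTheory.Automorphic Literature.NumberTheory.Automorphic.UnitaryGroup
open Literature.NumberTheory.GelbartRogawski1991 Literature.NumberTheory.GelbartRogawski1991.UnitaryDualPair
open HodgeCM.Adelic HodgeCM.PerL34 HodgeCM.Model.HypCensus
open HodgeCM.PerL34.Fock HodgeCM.PerL34.Fock.PrintDict

namespace HodgeCM.Model.ArchSideTerm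

/-! ## §1 the inverse printed weight at negated exponents -/

section Printed

variable {L : Type} [Field L] [NumberField L] [IsCMField L]

/-- `(archWeight (−n) x)⁻¹ = archWeight n x` — from the PKG currency `NumberField.archWeight` of pv11's printed-weight dictionary to the
Literature currency `Automorphic.archWeight` of the theta side (the two typed weights agree definitionally). -/
theorem inv_archWeight_neg_apply (n : InfinitePlace L → ℤ) (x : NumberField.unitaryLineArchTorus L) :
    (NumberField.archWeight L (fun w => -n w) x)⁻¹ = Literature.NumberTheory.Automorphic.archWeight L n x := by
  rw [show (fun w => -n w) = -n from rfl, NumberField.archWeight_neg, inv_inv]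
  rfl

variable (kind : InfinitePlace L → PlaceKind) (lam : InfinitePlace L → ℂ) (hlam : ∀ w, lam w ≠ 0)

/-- **`(w t)⁻¹ = archWeight n₁ (u_t)₀ · archWeight n₂ (u_t)₁`** for the pinned vacuum characters of exponents `(−n₁, −n₂)`, `u_t := placesEquiv⁻¹ (placesCoord t)`. -/
theorem inv_printPlacesW_pinned_neg (n₁ n₂ : InfinitePlace L → ℤ)
    (t : (printPlaces (InfinitePlace L) kind lam hlam (pinnedVacs kind (fun w => -n₁ w) (fun w => -n₂ w))).Tg) :
    (printPlacesW (InfinitePlace L) kind lam hlam (pinnedVacs kind (fun w => -n₁ w) (fun w => -n₂ w)) t)⁻¹ =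
      Literature.NumberTheory.Automorphic.archWeight L n₁ (NumberField.SeesawArchTorus.fst L
          ((NumberField.SeesawArchTorus.placesEquiv L).symm
            (placesCoord (InfinitePlace L) kind lam hlam (pinnedVacs kind (fun w => -n₁ w) (fun w => -n₂ w)) t))) *
        Literature.NumberTheory.Automorphic.archWeight L n₂ (NumberField.SeesawArchTorus.snd L
          ((NumberField.SeesawArchTorus.placesEquiv L).symm
            (placesCoord (InfinitePlace L) kind lam hlam (pinnedVacs kind (fun w => -n₁ w) (fun w => -n₂ w)) t))) := by
  rw [NumberField.SeesawArchTorus.printPlacesW_pinned_eq_weight, NumberField.SeesawArchTorus.weight_apply, mul_inv,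
    inv_archWeight_neg_apply, inv_archWeight_neg_apply]

end Printed

/-! ## §2 `hμ` at E's pin of record -/

section GOG

variable
  (hGR : ∀ {L : CMField} {ι₁ : L →+* ℂ} (V : HermSpace3 L ι₁) (c : SeesawCtx L),
    (cmSplittingDatum (L : Type) finProdFinEquiv (frameD V) (frameD_real V) (frameD_ne V) (dW c.D) (dW_real c.D)
      (dW_ne c.D)).CompatibleSplitting)
  (χV : ∀ {L : CMField} {ι₁ : L →+* ℂ} (_V : HermSpace3 L ι₁) (_c : SeesawCtx L),
    ContinuousMonoidHom (relNormOneIdeles (↥(maximalRealSubfield (L : Type))) (L : Type) ⧸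
      relNormOneRat (↥(maximalRealSubfield (L : Type))) (L : Type)) Circle)
  (hGR₀ : ∀ {L : CMField} {ι₁ : L →+* ℂ} (V : HermSpace3 L ι₁) (c : SeesawCtx L),
    (cmSplittingDatum (L : Type) (e₁) (frameD V) (frameD_real V) (frameD_ne V) (lineVec (L : Type) (dW c.D 0))
      (fun _ => dW_real c.D 0) (fun _ => dW_ne c.D 0)).CompatibleSplitting)
  (hGR₁ : ∀ {L : CMField} {ι₁ : L →+* ℂ} (V : HermSpace3 L ι₁) (c : SeesawCtx L),
    (cmSplittingDatum (L : Type) (e₁) (frameD V) (frameD_real V) (frameD_ne V) (lineVec (L : Type) (dW c.D 1))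
      (fun _ => dW_real c.D 1) (fun _ => dW_ne c.D 1)).CompatibleSplitting)
  (hGR₂ : ∀ {L : CMField} {ι₁ : L →+* ℂ} (V : HermSpace3 L ι₁) (c : SeesawCtx L),
    (cmSplittingDatum (L : Type) (e₁) (frameD V) (frameD_real V) (frameD_ne V) (lineVec (L : Type) (dW' c.D 0))
      (fun _ => dW'_real c.D 0) (fun _ => dW'_ne c.D 0)).CompatibleSplitting)
  (hGR₃ : ∀ {L : CMField} {ι₁ : L →+* ℂ} (V : HermSpace3 L ι₁) (c : SeesawCtx L),
    (cmSplittingDatum (L : Type) (e₁) (frameD V) (frameD_real V) (frameD_ne V) (lineVec (L : Type) (dW' c.D 1))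
      (fun _ => dW'_real c.D 1) (fun _ => dW'_ne c.D 1)).CompatibleSplitting)
  (μ : ∀ {L : CMField}, SeesawCtx L → Fin 4 → NumberField.InfinitePlace L → ℤ)

include hGR₂ hGR₃ in
/-- **binder-2's `hμ` AT E's PIN OF RECORD, DISCHARGED** (OG guard `SInstance.GOG`; Stage-B η with `χW := SInstance.χWR … (μ♯♯)`,
`μ♯♯ := muSharp₂₃ μ`; pinned exponents `m₁ := −μ♯♯ c 0`, `m₂ := −μ♯♯ c 1`; ANY place-datum family `datum`, ANY sign fact `hW`):
`η(1, (diag u_t)_𝔸) · χ_T(u_t) · dIotaAt(u_t) = (printPlacesW … t)⁻¹`, `u_t := archOf … t` — literally the hypothesis `hμ` of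
`HypCensus.omgW_ins_vacuum_eq_of_weight` ∕ (T12) `HypCensus.omgW_ins_eq_of_weight` (with `∏_w d w u` read as `dIotaAt u`). -/
theorem hμ_GOG {L : CMField} {ι₁ : L →+* ℂ} (V : HermSpace3 L ι₁) (c : SeesawCtx L) (hc : SInstance.GOG V c)
    (hW : (∀ j, 0 < (ι₁ ((dW c.D) j)).re) ∨ ∀ j, (ι₁ ((dW c.D) j)).re < 0)
    (datum : ∀ b : InfinitePlace (L : Type),
      PlaceDatum (L : Type) (frameD V) (frameD_real V) (dW c.D) (dW_real c.D) ι₁ (cmPlacesEquiv (L : Type) b))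
    (t : (printPlaces (InfinitePlace (L : Type)) (kindOf (L : Type) (frameD V) (frameD_real V) (dW c.D) (dW_real c.D) ι₁ datum)
      (lamOf (L : Type) (frameD V) (frameD_real V) (dW c.D) (dW_real c.D) ι₁ datum)
      (lamOf_ne_zero (L : Type) (frameD V) (frameD_real V) (dW c.D) (dW_real c.D) ι₁ datum)
      (pinnedVacs (kindOf (L : Type) (frameD V) (frameD_real V) (dW c.D) (dW_real c.D) ι₁ datum)
        (fun w => -(muSharp₂₃ @μ) c 0 w) (fun w => -(muSharp₂₃ @μ) c 1 w))).Tg) :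
    ((EtaChi.η @χV (@SInstance.χWR @hGR @hGR₀ @hGR₁ (muSharp₂₃ @μ)) V c
        (archProdHom (↥(maximalRealSubfield (L : Type))) (L : Type) (IsCMField.complexConj (L : Type)) 3 2 (Matrix.diagonal (frameD V))
          (Matrix.diagonal (dW c.D))
          ((1 : ↥(UnitaryGroup.arch (↥(maximalRealSubfield (L : Type))) (L : Type) (IsCMField.complexConj (L : Type)) 3 (Matrix.diagonal (frameD V)))),
            archDiag (L : Type) (dW c.D)
              (archOf V c.D datum (fun w => -(muSharp₂₃ @μ) c 0 w) (fun w => -(muSharp₂₃ @μ) c 1 w) t))) : ℂˣ) : ℂ) *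
        ((pinTorusChar V c.D (hGR V c) hW
            (archOf V c.D datum (fun w => -(muSharp₂₃ @μ) c 0 w) (fun w => -(muSharp₂₃ @μ) c 1 w) t) : Circle) : ℂ) *
          HypCensus.dIotaAt (L : Type) (frameD V) (dW c.D) (dW_real c.D) ι₁
            (archOf V c.D datum (fun w => -(muSharp₂₃ @μ) c 0 w) (fun w => -(muSharp₂₃ @μ) c 1 w) t) =
      (printPlacesW (InfinitePlace (L : Type)) (kindOf (L : Type) (frameD V) (frameD_real V) (dW c.D) (dW_real c.D) ι₁ datum)
        (lamOf (L : Type) (frameD V) (frameD_real V) (dW c.D) (dW_real c.D) ι₁ datum)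
        (lamOf_ne_zero (L : Type) (frameD V) (frameD_real V) (dW c.D) (dW_real c.D) ι₁ datum)
        (pinnedVacs (kindOf (L : Type) (frameD V) (frameD_real V) (dW c.D) (dW_real c.D) ι₁ datum)
          (fun w => -(muSharp₂₃ @μ) c 0 w) (fun w => -(muSharp₂₃ @μ) c 1 w)) t)⁻¹ := by
  rw [eta_pinTorusChar_dIotaAt_GOG hGR χV hGR₀ hGR₁ hGR₂ hGR₃ μ V c hc, inv_printPlacesW_pinned_neg]

end GOG

end HodgeCM.Model.ArchSideTerm

end
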